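import Literature.NumberTheory.Sieve.BVAssemblyCube
import Literature.NumberTheory.Sieve.TotientHarmonic
import HarnessLib

/-!
# Bombieri–Vinogradov over totally real fields: the character-sum chain at time `t`

Topic `Literature/NumberTheory/Sieve`, sub-namespace `BVAssembly` (continued). For the profile
`κ_t = kappaT a ε t` every constant of the character-sum chain is a fixed multiple of
`P_t := (log 2 − a + 3) D_t`, `D_t = kappaTD a ε t` (`SmoothProfileConstants`); this file
instantiates the chain at time `t` and factors out `P_t^d`:

* `core_at_t` — the large moduli (`SmoothBVCore.smoothBV_core`) `≤ P_t^d · R_core`;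
* `small_at_t` — the small moduli from the PNT hypothesis (`SmoothSmallModuli`) `≤ P_t^d · R_small`;
* `bad_at_t` — the non-coprime part (`badSum_le`) `≤ P_t^d · R_bad`;
* `chain_at_t` — `∑_{N𝔮≤Q} φ(𝔮)⁻¹(∑_{χ≠χ₀}‖ψ_{Ω_t}(χ)‖ + bad_t(𝔮)) ≤ P_t^d · 𝓡`.

## References

* J. Hinz, Acta Arith. 51 (1988), §2 and Theorem. [cite: Hinz1988, §2 pp. 177–178]
-/

noncomputable section

open Finset NumberField NumberField.InfinitePlace MeasureTheory Set
  Literature.NumberTheory.Sieve.NumberFieldLS Literature.NumberTheory.Sieve.BoxPrimes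
  Literature.NumberTheory.LFunctions Literature.NumberTheory.LFunctions.NumberField
  Literature.NumberTheory.Sieve.CastilloEtAl2015 Literature.NumberTheory.Sieve.TypeTwoReparam
  Literature.NumberTheory.Sieve.TypeTwoBlock Literature.NumberTheory.Sieve.SmoothCoset
  Literature.NumberTheory.Sieve.SmoothBVCore Literature.NumberTheory.Sieve.SmoothBVModuli
  Literature.NumberTheory.Sieve.SmoothStepA Literature.NumberTheory.Sieve.LogIntegral
  Literature.NumberTheory.Sieve.SmoothToSharp Literature.NumberTheory.Sieve.SmoothWeights
  Literature.NumberTheory.Sieve.ProfileConst Literature.NumberTheory.Sieve.MitsuiPNT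
  Literature.NumberTheory.Sieve.SmoothSmallModuli Literature.NumberTheory.Sieve.PrimRed
  Literature.NumberTheory.Sieve.LogSep Literature.NumberTheory.Sieve.TypeTwoBound
  Literature.NumberTheory.Sieve.SmoothTypeOne Literature.NumberTheory.LFunctions.HeckeCone
  NumberField.Units NumberField.Units.dirichletUnitTheorem Literature.NumberTheory.Sieve.MaynardNF
  Literature.NumberTheory.LFunctions.AbelianDensity
open scoped Classical FourierTransform

namespace Literature.NumberTheory.Sieve.BVAssembly

variable {K : Type*} [Field K] [NumberField K] [IsTotallyReal K]

local notation "d" => Module.finrank ℚ K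
local notation "RP" => {w : InfinitePlace K // IsReal w}
local notation "rk" => Module.finrank ℝ (logSpace K)

/-- `P_t := (log 2 − a + 3) · D_t`, the common size of all profile constants at time `t`. [folklore] -/
def PD (a ε t : ℝ) : ℝ := (Real.log 2 - a + 3) * kappaTD a ε t

omit [NumberField K] [IsTotallyReal K] in
/-- `P_t ≥ 0` for `a ≤ 0`, `ε > 0`, `t ≥ 0`. [folklore] -/
theorem PD_nonneg {a ε t : ℝ} (ha : a ≤ 0) (hε : 0 < ε) (ht : 0 ≤ t) : 0 ≤ PD a ε t := by
  have hl2 := Real.log_pos one_lt_two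
  exact mul_nonneg (by linarith) (kappaTD_nonneg a hε ht)

/-! ## The large moduli at time `t` -/

/-- **The core at time `t`**: with the constant `C` of `smoothBV_core`, for `κ_t = kappaT a ε t`
(`a ≤ 0`, `0 < ε ≤ 1`, `t ≥ 0`) and `3 ≤ M`, `1 ≤ U`, `1 ≤ Q₁ ≤ Q ≤ M^d`:
core sum `≤ P_t^d · C (X₁ + (48 e^{−3a})^d X₂ / M^d + decInt^d X₃)`. [cite: Hinz1988, §2 pp. 177–178] -/
theorem core_at_t : ∃ C : ℝ, 0 < C ∧ ∀ (a ε t : ℝ), a ≤ 0 → 0 < ε → ε ≤ 1 → 0 ≤ t →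
    ∀ (M U Q₁ Q : ℝ), 3 ≤ M → 1 ≤ U → 1 ≤ Q₁ → Q₁ ≤ Q → Q ≤ M ^ d →
    ∑ 𝔣 ∈ (idealsLE K Q).filter (fun 𝔣 => Q₁ < Ideal.absNorm 𝔣),
        (∑ χ ∈ primChars K 𝔣, ‖psiΩ K χ (kappaT a ε t) M‖) / Nat.card ((𝓞 K ⧸ 𝔣)ˣ) ≤
      PD a ε t ^ d * (C * ((1 + Real.log M) ^ rk * (idealsLE K Q).card * (Real.log U * (idealsLE K U).card) +
        (48 * Real.exp (-3 * a)) ^ d / M ^ d * ((U * Real.log U * (idealsLE K U).card) * (U * (idealsLE K U).card) +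
          (d * Real.log M + Real.log U + d) * (U * (idealsLE K U).card)) * (Q ^ 2 * (idealsLE K Q).card) +
        decInt ^ d * Real.log M ^ (rk + 3) * Real.sqrt (harmU K U ^ 3) *
          (Q * Real.sqrt (M ^ d) + M ^ d / Real.sqrt U + M ^ d / Q₁))) := by
  obtain ⟨C, hC, hcore⟩ := smoothBV_core (K := K)
  refine ⟨C, hC, fun a ε t ha hε hε1 ht M U Q₁ Q hM hU hQ₁ hQ hQM => ?_⟩
  have hD := kappaTD_nonneg a hε ht
  have hl2 := Real.log_pos one_lt_two
  have hP0 : 0 ≤ PD a ε t := PD_nonneg ha hε ht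
  obtain ⟨hg3, hgs, hg3', hgs'⟩ := gOfC_data (a := a) ha hε hε1 ht
  have hG0 : 0 ≤ 48 * ((Real.log 2 - a + 3) * kappaTD a ε t) * Real.exp (-3 * a) := by
    have : 0 ≤ (Real.log 2 - a + 3) * kappaTD a ε t := hP0
    positivity
  have h := hcore (kappaT a ε t) (kappaT_zero_of_nonneg hε t) (contDiff_kC a ε t) (hasCompactSupport_kC hε t)
    hg3 hgs hg3' hgs' ((Real.log 2 - a + 3) * kappaTD a ε t) (48 * ((Real.log 2 - a + 3) * kappaTD a ε t) * Real.exp (-3 * a))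
    (abs_kappaT_le_kappaTD ha hε hε1 ht) hG0 (fourier_decay_gOfC ha hε hε1 ht) (fourier_decay_gOfC_twist ha hε hε1 ht)
    M U Q₁ Q hM hU hQ₁ hQ hQM
  refine h.trans ?_
  · -- compare the three constants with `P_t`
    have hM1 : 1 ≤ M := by linarith
    have hM0 : 0 < M := by linarith
    have hQ0 : 0 ≤ Q := by linarith
    have hlogM : 0 ≤ Real.log M := Real.log_nonneg hM1
    have hlogU : 0 ≤ Real.log U := Real.log_nonneg hU
    have hHU := harmU_nonneg (K := K) U
    have hKk : (∫ τ, ‖𝓕 (fun v => (kappaT a ε t v : ℂ)) τ‖) ^ d ≤ (decInt * PD a ε t) ^ d :=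
      pow_le_pow_left₀ (integral_nonneg fun _ => norm_nonneg _) (integral_norm_fourier_kC_le ha hε hε1 ht) _
    have hG : (48 * ((Real.log 2 - a + 3) * kappaTD a ε t) * Real.exp (-3 * a)) ^ d = PD a ε t ^ d * (48 * Real.exp (-3 * a)) ^ d := by
      rw [← mul_pow]; unfold PD; ring
    -- term by term
    set X₁ := (1 + Real.log M) ^ rk * (idealsLE K Q).card * (Real.log U * (idealsLE K U).card) with hX₁
    set X₂ := ((U * Real.log U * (idealsLE K U).card) * (U * (idealsLE K U).card) +
          (d * Real.log M + Real.log U + d) * (U * (idealsLE K U).card)) * (Q ^ 2 * (idealsLE K Q).card) with hX₂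
    set X₃ := Real.log M ^ (rk + 3) * Real.sqrt (harmU K U ^ 3) * (Q * Real.sqrt (M ^ d) + M ^ d / Real.sqrt U + M ^ d / Q₁) with hX₃
    have hX₁0 : 0 ≤ X₁ := by positivity
    have hX₂0 : 0 ≤ X₂ := by positivity
    have hX₃0 : 0 ≤ X₃ := by positivity
    have e1 : ((Real.log 2 - a + 3) * kappaTD a ε t) ^ d * (1 + Real.log M) ^ rk * (idealsLE K Q).card * (Real.log U * (idealsLE K U).card) =
        PD a ε t ^ d * X₁ := by rw [hX₁]; unfold PD; ring
    have e2 : (48 * ((Real.log 2 - a + 3) * kappaTD a ε t) * Real.exp (-3 * a)) ^ d / M ^ d *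
        ((U * Real.log U * (idealsLE K U).card) * (U * (idealsLE K U).card) +
          (d * Real.log M + Real.log U + d) * (U * (idealsLE K U).card)) * (Q ^ 2 * (idealsLE K Q).card) =
        PD a ε t ^ d * ((48 * Real.exp (-3 * a)) ^ d / M ^ d * X₂) := by rw [hG, hX₂]; ring
    have e3 : (∫ τ, ‖𝓕 (fun v => (kappaT a ε t v : ℂ)) τ‖) ^ d * Real.log M ^ (rk + 3) * Real.sqrt (harmU K U ^ 3) *
        (Q * Real.sqrt (M ^ d) + M ^ d / Real.sqrt U + M ^ d / Q₁) ≤ PD a ε t ^ d * (decInt ^ d * X₃) := by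
      calc _ = (∫ τ, ‖𝓕 (fun v => (kappaT a ε t v : ℂ)) τ‖) ^ d * X₃ := by rw [hX₃]; ring
        _ ≤ (decInt * PD a ε t) ^ d * X₃ := mul_le_mul_of_nonneg_right hKk hX₃0
        _ = PD a ε t ^ d * (decInt ^ d * X₃) := by rw [mul_pow]; ring
    calc C * (((Real.log 2 - a + 3) * kappaTD a ε t) ^ d * (1 + Real.log M) ^ rk * (idealsLE K Q).card * (Real.log U * (idealsLE K U).card) +
          (48 * ((Real.log 2 - a + 3) * kappaTD a ε t) * Real.exp (-3 * a)) ^ d / M ^ d *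
            ((U * Real.log U * (idealsLE K U).card) * (U * (idealsLE K U).card) +
              (d * Real.log M + Real.log U + d) * (U * (idealsLE K U).card)) * (Q ^ 2 * (idealsLE K Q).card) +
          (∫ τ, ‖𝓕 (fun v => (kappaT a ε t v : ℂ)) τ‖) ^ d * Real.log M ^ (rk + 3) * Real.sqrt (harmU K U ^ 3) *
            (Q * Real.sqrt (M ^ d) + M ^ d / Real.sqrt U + M ^ d / Q₁))
        ≤ C * (PD a ε t ^ d * X₁ + PD a ε t ^ d * ((48 * Real.exp (-3 * a)) ^ d / M ^ d * X₂) + PD a ε t ^ d * (decInt ^ d * X₃)) := by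
          rw [e1, e2]; exact mul_le_mul_of_nonneg_left (by linarith [e3]) hC.le
      _ = _ := by rw [hX₂, hX₃]; ring

/-! ## The small moduli at time `t` -/

variable (K) in
/-- Mitsui's main term for the box `ℜ(y)` (totally real, degree `d`):
`I(y) = (w / (2^d h R)) ∫_{∏[2, y_w]} du / log(u₁⋯u_d)` (Hinz p. 175). [cite: Hinz1988, §1 p. 175 (I)] -/
def mitsuiMain (y : RP → ℝ) : ℝ :=
  torsionOrder K / (2 ^ d * classNumber K * regulator K) *
    ∫ u in Set.pi Set.univ (fun w : RP => Set.Icc (2 : ℝ) (y w)), (Real.log (∏ w, u w))⁻¹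

/-- The derivative `L¹` products of the profile families are `≤ (2 e^{−a} P_t)^d`. [folklore] -/
theorem prod_integral_deriv_le {a ε t : ℝ} (ha : a ≤ 0) (hε : 0 < ε) (hε1 : ε ≤ 1) (ht : 0 ≤ t)
    (kf : RP → ℝ → ℝ) (hkf : ∀ w, kf w = kappaT a ε t ∨ kf w = fun v => v * kappaT a ε t v) :
    (∏ w, ∫ x, ‖deriv (gOf (kf w)) x‖) ≤ (2 * Real.exp (-a) * PD a ε t) ^ d := by
  obtain ⟨h1, h2⟩ := integral_norm_deriv_gOf_kappaT_le ha hε hε1 ht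
  rw [← card_RP_eq (K := K), ← Finset.card_univ, ← Finset.prod_const]
  refine Finset.prod_le_prod (fun w _ => integral_nonneg fun _ => norm_nonneg _) fun w _ => ?_
  unfold PD
  rcases hkf w with h | h <;> rw [h]
  · linarith
  · linarith

/-- **The small moduli at time `t`.** Given the PNT data (`c, C_P, x₀, A`) for the shape constants
of the balancing constant `C_b`, for `κ_t` (`a ≤ 0`, `0 < ε ≤ 1`, `t ≥ 0`), `M ≥ 1` with
`v₀ = (M e^a/2)^d ≥ max(x₀, 3)` and `1 ≤ Q₁ ≤ (log v₀)^A`: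
`∑_{N𝔣≤Q₁, 𝔣≠1} φ(𝔣)⁻¹ ∑_{ψ prim} ‖ψ_{Ω_t}(ψ)‖ ≤ P_t^d · #I(Q₁) ((d log M + d)(2e^{−a})^d Q₁ C_P M^d e^{−c√log v₀} + d log M · #PP)`.
[cite: Hinz1988, §2 p. 178] -/
theorem small_at_t {Cb : ℝ} (hCb1 : 1 ≤ Cb)
    (hbal : ∀ s : InfinitePlace K → ℝ, (∀ w, 0 < s w) → ∃ u : (𝓞 K)ˣ, u ∈ posUnits K ∧
      ∀ w : InfinitePlace K, w ((u : 𝓞 K) : K) * s w ≤ Cb * (∏ w', s w') ^ (1 / (d : ℝ)))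
    {A c C x₀ : ℝ} (hc : 0 < c) (hC : 0 ≤ C) (hA : 0 ≤ A)
    (hPNT : ∀ y : RP → ℝ, x₀ ≤ ∏ w, y w →
      (∀ w, (Cb ^ (d - 1))⁻¹ * (∏ w', y w') ^ (1 / (d : ℝ)) ≤ y w ∧ y w ≤ Cb * (∏ w', y w') ^ (1 / (d : ℝ))) →
      ∀ 𝔮 : Ideal (𝓞 K), 𝔮 ≠ ⊥ → (Ideal.absNorm 𝔮 : ℝ) ≤ Real.log (∏ w, y w) ^ A →
      ∀ γ : (𝓞 K ⧸ 𝔮)ˣ, |(primeBoxCount K y 𝔮 (γ : 𝓞 K ⧸ 𝔮) : ℝ) - mitsuiMain K y / Nat.card ((𝓞 K ⧸ 𝔮)ˣ)| ≤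
        C * (∏ w, y w) * Real.exp (-(c * Real.sqrt (Real.log (∏ w, y w)))))
    {a ε t : ℝ} (ha : a ≤ 0) (hε : 0 < ε) (hε1 : ε ≤ 1) (ht : 0 ≤ t)
    {M : ℝ} (hM : 1 ≤ M) (hv₀ : x₀ ≤ (M * (Real.exp a / 2)) ^ d) (hv₀3 : 3 ≤ (M * (Real.exp a / 2)) ^ d)
    {Q₁ : ℝ} (hQ₁ : 1 ≤ Q₁) (hQ₁A : Q₁ ≤ Real.log ((M * (Real.exp a / 2)) ^ d) ^ A) :
    ∑ 𝔣 ∈ (idealsLE K Q₁).filter (· ≠ ⊤), (idealTotient K 𝔣)⁻¹ * ∑ ψ ∈ primChars K 𝔣, ‖psiΩ K ψ (kappaT a ε t) M‖ ≤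
      PD a ε t ^ d * ((idealsLE K Q₁).card * ((d * Real.log M + d) * ((2 * Real.exp (-a)) ^ d *
        (Q₁ * (C * M ^ d * Real.exp (-(c * Real.sqrt (Real.log ((M * (Real.exp a / 2)) ^ d))))))) +
        d * Real.log M * (ppSet K M).card)) := by
  have hM0 : 0 < M := by linarith
  have hlogM : 0 ≤ Real.log M := Real.log_nonneg hM
  have hP0 := PD_nonneg (ε := ε) ha hε ht
  set E₀ := C * M ^ d * Real.exp (-(c * Real.sqrt (Real.log ((M * (Real.exp a / 2)) ^ d)))) with hE₀
  have hE₀0 : 0 ≤ E₀ := by positivity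
  -- the bound per modulus
  set B := PD a ε t ^ d * ((d * Real.log M + d) * ((2 * Real.exp (-a)) ^ d * (Q₁ * E₀)) +
    d * Real.log M * (ppSet K M).card) with hB
  have hQ₁0 : 0 ≤ Q₁ := by linarith
  have hB0 : 0 ≤ B := by positivity
  have hper : ∀ 𝔣 ∈ (idealsLE K Q₁).filter (· ≠ ⊤),
      (idealTotient K 𝔣)⁻¹ * ∑ ψ ∈ primChars K 𝔣, ‖psiΩ K ψ (kappaT a ε t) M‖ ≤ B := by
    intro 𝔣 h𝔣
    rw [Finset.mem_filter] at h𝔣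
    obtain ⟨h𝔣Q, h𝔣top⟩ := h𝔣
    obtain ⟨h𝔣0, h𝔣N⟩ := mem_idealsLE.1 h𝔣Q
    haveI : Finite (𝓞 K ⧸ 𝔣) := Ideal.finiteQuotientOfFreeOfNeBot 𝔣 h𝔣0
    letI : Fintype ((𝓞 K ⧸ 𝔣)ˣ) := Fintype.ofFinite _
    have hφ := idealTotient_pos (K := K) h𝔣0
    have hφeq : idealTotient K 𝔣 = Nat.card ((𝓞 K ⧸ 𝔣)ˣ) := idealTotient_eq_natCard_units h𝔣0
    -- `card units ≤ N𝔣 ≤ Q₁`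
    have hcardQ : (Fintype.card ((𝓞 K ⧸ 𝔣)ˣ) : ℝ) ≤ Q₁ := by
      have h1 : Fintype.card ((𝓞 K ⧸ 𝔣)ˣ) ≤ Nat.card (𝓞 K ⧸ 𝔣) := by
        rw [← Nat.card_eq_fintype_card]
        exact Nat.card_le_card_of_injective _ Units.val_injective
      have h2 : Nat.card (𝓞 K ⧸ 𝔣) = Ideal.absNorm 𝔣 := (Ideal.absNorm_apply 𝔣 ▸ (Submodule.cardQuot_apply 𝔣).symm).symm
      calc (Fintype.card ((𝓞 K ⧸ 𝔣)ˣ) : ℝ) ≤ Nat.card (𝓞 K ⧸ 𝔣) := by exact_mod_cast h1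
        _ = Ideal.absNorm 𝔣 := by rw [h2]
        _ ≤ Q₁ := h𝔣N
    -- the norm condition of the PNT
    have hN𝔣 : (Ideal.absNorm 𝔣 : ℝ) ≤ Real.log ((M * (Real.exp a / 2)) ^ d) ^ A := h𝔣N.trans hQ₁A
    -- each primitive `ψ` (hence `ψ ≠ χ₀`)
    have hψ : ∀ ψ ∈ primChars K 𝔣, ‖psiΩ K ψ (kappaT a ε t) M‖ ≤ B := by
      intro ψ hψ
      have hprim := (mem_primChars h𝔣0).1 hψ
      have hψ0 : ψ ≠ 0 := ne_zero_of_isPrimitiveChar hprim h𝔣top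
      -- the box bound
      have hbox : ∀ s : RP → ℝ, (∀ w, Real.exp a / 2 ≤ s w ∧ s w ≤ 1) →
          ‖∑ γ : (𝓞 K ⧸ 𝔣)ˣ, toMulHom ψ γ * (primeBoxCount K (fun w => M * s w) 𝔣 (γ : 𝓞 K ⧸ 𝔣) : ℂ)‖ ≤
            Fintype.card ((𝓞 K ⧸ 𝔣)ˣ) * E₀ :=
        fun s hs => boxBound_of_PNT hCb1 hbal hc hC hPNT hM0 hA hv₀ hv₀3 h𝔣0 hN𝔣 hψ0 hs
      -- the `Θ` bounds for the constant family and the twists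
      have hθ : ∀ kf : RP → ℝ → ℝ, (∀ w, kf w = kappaT a ε t ∨ kf w = fun v => v * kappaT a ε t v) →
          ‖theta K kf M ψ‖ ≤ (2 * Real.exp (-a) * PD a ε t) ^ d * (Fintype.card ((𝓞 K ⧸ 𝔣)ˣ) * E₀) := by
        intro kf hkf
        have hk : ∀ w, ContDiff ℝ (⊤ : ℕ∞) (kf w) := fun w => by
          rcases hkf w with h | h <;> rw [h]
          · exact contDiff_kappaT a ε t
          · rw [mul_kappaT_eq_kappaTL]; exact contDiff_kappaTL a ε t
        have hlo : ∀ w v, v ≤ a - Real.log 2 → kf w v = 0 := fun w v hv => by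
          rcases hkf w with h | h <;> rw [h]
          · exact kappaT_eq_zero_of_le hv
          · show v * kappaT a ε t v = 0
            rw [kappaT_eq_zero_of_le hv, mul_zero]
        have hhi : ∀ w v, 0 ≤ v → kf w v = 0 := fun w v hv => by
          rcases hkf w with h | h <;> rw [h]
          · exact kappaT_eq_zero_of_ge hε hv
          · show v * kappaT a ε t v = 0
            rw [kappaT_eq_zero_of_ge hε hv, mul_zero]
        refine (norm_theta_le_of_boxBound hk hlo hhi hM0 ψ hbox).trans ?_
        exact mul_le_mul_of_nonneg_right (prod_integral_deriv_le ha hε hε1 ht kf hkf) (by positivity)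
      have hθ0 := hθ (fun _ => kappaT a ε t) fun _ => Or.inl rfl
      have hθw : ∀ w₀ : RP, ‖theta K (twistFam (kappaT a ε t) w₀) M ψ‖ ≤
          (2 * Real.exp (-a) * PD a ε t) ^ d * (Fintype.card ((𝓞 K ⧸ 𝔣)ˣ) * E₀) := fun w₀ =>
        hθ _ fun w => by
          unfold twistFam
          by_cases hw : w = w₀
          · subst hw; right; rw [Function.update_self]
          · left; rw [Function.update_of_ne hw]
      have hmain := norm_psiΩ_le_of_theta (abs_kappaT_le_kappaTD ha hε hε1 ht) hM h𝔣0 ψ hθ0 hθw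
      refine hmain.trans ?_
      -- compare with `B`
      rw [hB]
      have hPD : ((Real.log 2 - a + 3) * kappaTD a ε t) ^ d = PD a ε t ^ d := rfl
      rw [hPD]
      have h1 : (d * Real.log M + d) * ((2 * Real.exp (-a) * PD a ε t) ^ d * (Fintype.card ((𝓞 K ⧸ 𝔣)ˣ) * E₀)) ≤
          PD a ε t ^ d * ((d * Real.log M + d) * ((2 * Real.exp (-a)) ^ d * (Q₁ * E₀))) := by
        rw [mul_pow]
        have : (Fintype.card ((𝓞 K ⧸ 𝔣)ˣ) : ℝ) * E₀ ≤ Q₁ * E₀ := mul_le_mul_of_nonneg_right hcardQ hE₀0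
        have h2 : 0 ≤ (d * Real.log M + d) * ((2 * Real.exp (-a)) ^ d * PD a ε t ^ d) := by positivity
        calc (d * Real.log M + d) * ((2 * Real.exp (-a)) ^ d * PD a ε t ^ d * (Fintype.card ((𝓞 K ⧸ 𝔣)ˣ) * E₀))
            = (d * Real.log M + d) * ((2 * Real.exp (-a)) ^ d * PD a ε t ^ d) * (Fintype.card ((𝓞 K ⧸ 𝔣)ˣ) * E₀) := by ring
          _ ≤ (d * Real.log M + d) * ((2 * Real.exp (-a)) ^ d * PD a ε t ^ d) * (Q₁ * E₀) := mul_le_mul_of_nonneg_left this h2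
          _ = _ := by ring
      rw [mul_add]
      refine add_le_add h1 (le_of_eq ?_)
      unfold ppSet
      ring
    -- average over `ψ`
    calc (idealTotient K 𝔣)⁻¹ * ∑ ψ ∈ primChars K 𝔣, ‖psiΩ K ψ (kappaT a ε t) M‖
        ≤ (idealTotient K 𝔣)⁻¹ * ∑ _ψ ∈ primChars K 𝔣, B :=
          mul_le_mul_of_nonneg_left (Finset.sum_le_sum hψ) (inv_nonneg.2 hφ.le)
      _ = (primChars K 𝔣).card / idealTotient K 𝔣 * B := by rw [Finset.sum_const, nsmul_eq_mul]; ring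
      _ ≤ 1 * B := by
          refine mul_le_mul_of_nonneg_right ?_ hB0
          rw [div_le_one hφ, hφeq]
          exact card_primChars_le h𝔣0
      _ = B := one_mul _
  calc _ ≤ ∑ _𝔣 ∈ (idealsLE K Q₁).filter (· ≠ ⊤), B := Finset.sum_le_sum hper
    _ = ((idealsLE K Q₁).filter (· ≠ ⊤)).card * B := by rw [Finset.sum_const, nsmul_eq_mul]
    _ ≤ (idealsLE K Q₁).card * B := mul_le_mul_of_nonneg_right (by exact_mod_cast Finset.card_filter_le _ _) hB0
    _ = _ := by rw [hB]; ring

/-! ## The non-coprime part at time `t` -/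

/-- **The bad part at time `t`**: with the generator-count constant `C_g`, for `M ≥ 1`, `Q ≥ 1`:
`∑_{N𝔮≤Q} bad_t(𝔮) ≤ P_t^d #I(Q) C_g(1+log M)^{rk}(log₂⌊M^d⌋+1) log Q` and the same with weights
`φ(𝔮)⁻¹` and `∑ φ⁻¹` in place of `#I(Q)`. [cite: Hinz1988, §2 (2.2)] -/
theorem bad_at_t {Cg : ℝ} (hCg0 : 0 ≤ Cg)
    (hCg : ∀ X : ℝ, 1 ≤ X → ∀ I : Ideal (𝓞 K),
      (Nat.card {α : 𝓞 K // α ∈ box₀ K X ∧ Ideal.span {α} = I} : ℝ) ≤ Cg * (1 + Real.log X) ^ rk)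
    {a ε t : ℝ} (ha : a ≤ 0) (hε : 0 < ε) (hε1 : ε ≤ 1) (ht : 0 ≤ t) {M : ℝ} (hM : 1 ≤ M) (Q : ℝ) :
    (∑ 𝔮 ∈ idealsLE K Q, badSum (cubeF K M) (W K (kappaT a ε t) M) 𝔮 ≤
      PD a ε t ^ d * ((idealsLE K Q).card * (Cg * (1 + Real.log M) ^ rk * ((Nat.log 2 ⌊M ^ d⌋₊ + 1 : ℕ) * Real.log Q)))) ∧
    (∑ 𝔮 ∈ idealsLE K Q, (idealTotient K 𝔮)⁻¹ * badSum (cubeF K M) (W K (kappaT a ε t) M) 𝔮 ≤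
      PD a ε t ^ d * ((∑ 𝔤 ∈ idealsLE K Q, (idealTotient K 𝔤)⁻¹) *
        (Cg * (1 + Real.log M) ^ rk * ((Nat.log 2 ⌊M ^ d⌋₊ + 1 : ℕ) * Real.log Q)))) := by
  have hP0 := PD_nonneg (ε := ε) ha hε ht
  have hlogM : 0 ≤ Real.log M := Real.log_nonneg hM
  have hper : ∀ 𝔮 ∈ idealsLE K Q, badSum (cubeF K M) (W K (kappaT a ε t) M) 𝔮 ≤
      PD a ε t ^ d * (Cg * (1 + Real.log M) ^ rk * ((Nat.log 2 ⌊M ^ d⌋₊ + 1 : ℕ) * Real.log Q)) := by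
    intro 𝔮 h𝔮
    obtain ⟨h𝔮0, h𝔮N⟩ := mem_idealsLE.1 h𝔮
    have h := badSum_le (abs_kappaT_le_kappaTD ha hε hε1 ht) hCg0 hCg hM h𝔮0
    refine h.trans ?_
    have hPD : ((Real.log 2 - a + 3) * kappaTD a ε t) ^ d = PD a ε t ^ d := rfl
    rw [hPD]
    have h1 : (1 : ℝ) ≤ Ideal.absNorm 𝔮 := by
      exact_mod_cast Nat.one_le_iff_ne_zero.2 (by rw [Ne, Ideal.absNorm_eq_zero_iff]; exact h𝔮0)
    have hlogq : Real.log (Ideal.absNorm 𝔮 : ℝ) ≤ Real.log Q := Real.log_le_log (by linarith) h𝔮N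
    have hlogq0 : 0 ≤ Real.log (Ideal.absNorm 𝔮 : ℝ) := Real.log_nonneg h1
    refine mul_le_mul_of_nonneg_left (mul_le_mul_of_nonneg_left (mul_le_mul_of_nonneg_left hlogq (by positivity))
      (by positivity)) (by positivity)
  constructor
  · calc _ ≤ ∑ _𝔮 ∈ idealsLE K Q, PD a ε t ^ d * (Cg * (1 + Real.log M) ^ rk * ((Nat.log 2 ⌊M ^ d⌋₊ + 1 : ℕ) * Real.log Q)) :=
          Finset.sum_le_sum hper
      _ = _ := by rw [Finset.sum_const, nsmul_eq_mul]; ring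
  · calc _ ≤ ∑ 𝔮 ∈ idealsLE K Q, (idealTotient K 𝔮)⁻¹ *
          (PD a ε t ^ d * (Cg * (1 + Real.log M) ^ rk * ((Nat.log 2 ⌊M ^ d⌋₊ + 1 : ℕ) * Real.log Q))) :=
          Finset.sum_le_sum fun 𝔮 h𝔮 => mul_le_mul_of_nonneg_left (hper 𝔮 h𝔮)
            (inv_nonneg.2 (idealTotient_pos (K := K) (mem_idealsLE.1 h𝔮).1).le)
      _ = _ := by rw [← Finset.sum_mul]; ring

/-! ## The whole chain at time `t` -/

/-- **The character-sum chain at time `t`.** For `κ_t` (`a ≤ 0`, `0 < ε ≤ 1`, `t ≥ 0`), `3 ≤ M`,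
`1 ≤ U`, `1 ≤ Q₁ ≤ Q ≤ M^d`, the PNT data with `(M e^a/2)^d ≥ max(x₀,3)`, `Q₁ ≤ (log v₀)^A`:
`∑_{N𝔮≤Q} φ(𝔮)⁻¹(∑_{χ≠χ₀}‖ψ_{Ω_t}(χ)‖ + bad_t(𝔮)) ≤ P_t^d (H_Q (R_small + R_core) + (#I(Q) + H_Q) R_bad)`,
`H_Q = ∑_{N𝔤≤Q} φ(𝔤)⁻¹`. [cite: Hinz1988, §2 pp. 177–178] -/
theorem chain_at_t {C : ℝ}
    (hcore : ∀ (a ε t : ℝ), a ≤ 0 → 0 < ε → ε ≤ 1 → 0 ≤ t →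
      ∀ (M U Q₁ Q : ℝ), 3 ≤ M → 1 ≤ U → 1 ≤ Q₁ → Q₁ ≤ Q → Q ≤ M ^ d →
      ∑ 𝔣 ∈ (idealsLE K Q).filter (fun 𝔣 => Q₁ < Ideal.absNorm 𝔣),
          (∑ χ ∈ primChars K 𝔣, ‖psiΩ K χ (kappaT a ε t) M‖) / Nat.card ((𝓞 K ⧸ 𝔣)ˣ) ≤
        PD a ε t ^ d * (C * ((1 + Real.log M) ^ rk * (idealsLE K Q).card * (Real.log U * (idealsLE K U).card) +
          (48 * Real.exp (-3 * a)) ^ d / M ^ d * ((U * Real.log U * (idealsLE K U).card) * (U * (idealsLE K U).card) +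
            (d * Real.log M + Real.log U + d) * (U * (idealsLE K U).card)) * (Q ^ 2 * (idealsLE K Q).card) +
          decInt ^ d * Real.log M ^ (rk + 3) * Real.sqrt (harmU K U ^ 3) *
            (Q * Real.sqrt (M ^ d) + M ^ d / Real.sqrt U + M ^ d / Q₁))))
    {Cg : ℝ} (hCg0 : 0 ≤ Cg)
    (hCg : ∀ X : ℝ, 1 ≤ X → ∀ I : Ideal (𝓞 K),
      (Nat.card {α : 𝓞 K // α ∈ box₀ K X ∧ Ideal.span {α} = I} : ℝ) ≤ Cg * (1 + Real.log X) ^ rk)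
    {Cb : ℝ} (hCb1 : 1 ≤ Cb)
    (hbal : ∀ s : InfinitePlace K → ℝ, (∀ w, 0 < s w) → ∃ u : (𝓞 K)ˣ, u ∈ posUnits K ∧
      ∀ w : InfinitePlace K, w ((u : 𝓞 K) : K) * s w ≤ Cb * (∏ w', s w') ^ (1 / (d : ℝ)))
    {A c CP x₀ : ℝ} (hc : 0 < c) (hCP : 0 ≤ CP) (hA : 0 ≤ A)
    (hPNT : ∀ y : RP → ℝ, x₀ ≤ ∏ w, y w →
      (∀ w, (Cb ^ (d - 1))⁻¹ * (∏ w', y w') ^ (1 / (d : ℝ)) ≤ y w ∧ y w ≤ Cb * (∏ w', y w') ^ (1 / (d : ℝ))) →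
      ∀ 𝔮 : Ideal (𝓞 K), 𝔮 ≠ ⊥ → (Ideal.absNorm 𝔮 : ℝ) ≤ Real.log (∏ w, y w) ^ A →
      ∀ γ : (𝓞 K ⧸ 𝔮)ˣ, |(primeBoxCount K y 𝔮 (γ : 𝓞 K ⧸ 𝔮) : ℝ) - mitsuiMain K y / Nat.card ((𝓞 K ⧸ 𝔮)ˣ)| ≤
        CP * (∏ w, y w) * Real.exp (-(c * Real.sqrt (Real.log (∏ w, y w)))))
    {a ε t : ℝ} (ha : a ≤ 0) (hε : 0 < ε) (hε1 : ε ≤ 1) (ht : 0 ≤ t)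
    {M U Q₁ Q : ℝ} (hM : 3 ≤ M) (hU : 1 ≤ U) (hQ₁ : 1 ≤ Q₁) (hQ : Q₁ ≤ Q) (hQM : Q ≤ M ^ d)
    (hv₀ : x₀ ≤ (M * (Real.exp a / 2)) ^ d) (hv₀3 : 3 ≤ (M * (Real.exp a / 2)) ^ d)
    (hQ₁A : Q₁ ≤ Real.log ((M * (Real.exp a / 2)) ^ d) ^ A) :
    ∑ 𝔮 ∈ idealsLE K Q, (idealTotient K 𝔮)⁻¹ *
        (∑ χ ∈ nonprincipalChars K 𝔮, ‖psiΩ K χ (kappaT a ε t) M‖ + badSum (cubeF K M) (W K (kappaT a ε t) M) 𝔮) ≤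
      PD a ε t ^ d * ((∑ 𝔤 ∈ idealsLE K Q, (idealTotient K 𝔤)⁻¹) *
        (((idealsLE K Q₁).card * ((d * Real.log M + d) * ((2 * Real.exp (-a)) ^ d *
          (Q₁ * (CP * M ^ d * Real.exp (-(c * Real.sqrt (Real.log ((M * (Real.exp a / 2)) ^ d))))))) +
          d * Real.log M * (ppSet K M).card)) +
        (C * ((1 + Real.log M) ^ rk * (idealsLE K Q).card * (Real.log U * (idealsLE K U).card) +
          (48 * Real.exp (-3 * a)) ^ d / M ^ d * ((U * Real.log U * (idealsLE K U).card) * (U * (idealsLE K U).card) +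
            (d * Real.log M + Real.log U + d) * (U * (idealsLE K U).card)) * (Q ^ 2 * (idealsLE K Q).card) +
          decInt ^ d * Real.log M ^ (rk + 3) * Real.sqrt (harmU K U ^ 3) *
            (Q * Real.sqrt (M ^ d) + M ^ d / Real.sqrt U + M ^ d / Q₁)))) +
        ((idealsLE K Q).card + ∑ 𝔤 ∈ idealsLE K Q, (idealTotient K 𝔤)⁻¹) *
          (Cg * (1 + Real.log M) ^ rk * ((Nat.log 2 ⌊M ^ d⌋₊ + 1 : ℕ) * Real.log Q))) := by
  have hM1 : 1 ≤ M := by linarith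
  -- abbreviations
  set k := kappaT a ε t with hk
  set HQ := ∑ 𝔤 ∈ idealsLE K Q, (idealTotient K 𝔤)⁻¹ with hHQ
  have hHQ0 : 0 ≤ HQ := Finset.sum_nonneg fun 𝔤 h𝔤 => inv_nonneg.2 (idealTotient_pos (K := K) (mem_idealsLE.1 h𝔤).1).le
  -- the four inputs
  have h1 := sum_nonprincipal_le (K := K) k M Q
  have h2 := sum_primitive_split (K := K) k M Q₁ Q
  have h3 := hcore a ε t ha hε hε1 ht M U Q₁ Q hM hU hQ₁ hQ hQM
  have h4 := small_at_t hCb1 hbal hc hCP hA hPNT ha hε hε1 ht hM1 hv₀ hv₀3 hQ₁ hQ₁A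
  obtain ⟨h5, h6⟩ := bad_at_t hCg0 hCg ha hε hε1 ht hM1 Q (K := K)
  rw [← hk] at h3 h4 h5 h6
  -- combine
  set Ssmall := ∑ 𝔣 ∈ (idealsLE K Q₁).filter (· ≠ ⊤), (idealTotient K 𝔣)⁻¹ * ∑ ψ ∈ primChars K 𝔣, ‖psiΩ K ψ k M‖ with hSs
  set Score := ∑ 𝔣 ∈ (idealsLE K Q).filter (fun 𝔣 => Q₁ < Ideal.absNorm 𝔣),
    (∑ ψ ∈ primChars K 𝔣, ‖psiΩ K ψ k M‖) / Nat.card ((𝓞 K ⧸ 𝔣)ˣ) with hSc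
  set Sbad := ∑ 𝔮 ∈ idealsLE K Q, badSum (cubeF K M) (W K k M) 𝔮 with hSb
  set Sbad' := ∑ 𝔮 ∈ idealsLE K Q, (idealTotient K 𝔮)⁻¹ * badSum (cubeF K M) (W K k M) 𝔮 with hSb'
  set Rs := (idealsLE K Q₁).card * ((d * Real.log M + d) * ((2 * Real.exp (-a)) ^ d *
    (Q₁ * (CP * M ^ d * Real.exp (-(c * Real.sqrt (Real.log ((M * (Real.exp a / 2)) ^ d))))))) +
      d * Real.log M * (ppSet K M).card) with hRs
  set Rc := C * ((1 + Real.log M) ^ rk * (idealsLE K Q).card * (Real.log U * (idealsLE K U).card) +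
    (48 * Real.exp (-3 * a)) ^ d / M ^ d * ((U * Real.log U * (idealsLE K U).card) * (U * (idealsLE K U).card) +
      (d * Real.log M + Real.log U + d) * (U * (idealsLE K U).card)) * (Q ^ 2 * (idealsLE K Q).card) +
    decInt ^ d * Real.log M ^ (rk + 3) * Real.sqrt (harmU K U ^ 3) *
      (Q * Real.sqrt (M ^ d) + M ^ d / Real.sqrt U + M ^ d / Q₁)) with hRc
  set Rb := Cg * (1 + Real.log M) ^ rk * ((Nat.log 2 ⌊M ^ d⌋₊ + 1 : ℕ) * Real.log Q) with hRb
  have hsplit : ∑ 𝔮 ∈ idealsLE K Q, (idealTotient K 𝔮)⁻¹ *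
      (∑ χ ∈ nonprincipalChars K 𝔮, ‖psiΩ K χ k M‖ + badSum (cubeF K M) (W K k M) 𝔮) =
      (∑ 𝔮 ∈ idealsLE K Q, (idealTotient K 𝔮)⁻¹ * ∑ χ ∈ nonprincipalChars K 𝔮, ‖psiΩ K χ k M‖) + Sbad' := by
    rw [hSb', ← Finset.sum_add_distrib]
    exact Finset.sum_congr rfl fun _ _ => by ring
  rw [hsplit]
  have hA' : ∑ 𝔮 ∈ idealsLE K Q, (idealTotient K 𝔮)⁻¹ * ∑ χ ∈ nonprincipalChars K 𝔮, ‖psiΩ K χ k M‖ ≤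
      HQ * (Ssmall + Score) + Sbad := h1.trans (by
        rw [hHQ, hSs, hSc, hSb]
        exact add_le_add (mul_le_mul_of_nonneg_left h2 hHQ0) le_rfl)
  have hB' : HQ * (Ssmall + Score) + Sbad + Sbad' ≤
      HQ * (PD a ε t ^ d * Rs + PD a ε t ^ d * Rc) + PD a ε t ^ d * ((idealsLE K Q).card * Rb) + PD a ε t ^ d * (HQ * Rb) := by
    exact add_le_add (add_le_add (mul_le_mul_of_nonneg_left (add_le_add h4 h3) hHQ0) h5) h6
  calc _ ≤ HQ * (Ssmall + Score) + Sbad + Sbad' := by linarith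
    _ ≤ HQ * (PD a ε t ^ d * Rs + PD a ε t ^ d * Rc) + PD a ε t ^ d * ((idealsLE K Q).card * Rb) + PD a ε t ^ d * (HQ * Rb) := hB'
    _ = PD a ε t ^ d * (HQ * (Rs + Rc) + ((idealsLE K Q).card + HQ) * Rb) := by ring

end Literature.NumberTheory.Sieve.BVAssembly
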